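import Summits.ResolutionOfSingularities.ResolutionOfSingularities.Theorems.FrobeniusLadderFRationalResolutionFixedRechart
import HarnessLib

/-!
# Crux `FrobeniusLadder.FRationalResolution` (stmt-ResolutionOfSingularities-15317), line `redirect`,
# stub `stub_diagonalizableQuotientResolution` — item (F2) in the stub's LITERAL vocabulary: the hypothesis `hq` (every point lies in the
# image of an étale quotient chart `Spec S₀ → X`, `S` regular of finite type graded by a finite abelian group) implies its FIXED form
# (every point is the image of the contraction of a `D(A)`-FIXED prime of such a chart)

* ★★★★★ `fixed_charts_of_charts` — `hq ⇒ hq_fixed`, by `…FixedRechart.exists_fixed_rechart`.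

So the consumer of the stub may start from fixed points: the remaining work on `stub_diagonalizableQuotientResolution` is the resolution
of the local models at FIXED points (`…FixedPoint*`, `…FixedPointResolution*`: isolated Veronese-type / regular-vertex-blow-up models are
done) and the non-isolated case. Honest label: helper toward ONE leaf stub; no stub, crux or summit closed. No definitions, no named
facts, no sorry. [folklore; cite: SGA3, Exp. VIII §4–5]
-/

noncomputable section

-- single-problem summit: the doubled namespace component is forced
set_option linter.dupNamespace false

open CategoryTheory AlgebraicGeometry
open Literature.AlgebraicGeometry.Resolution

namespace Summit.ResolutionOfSingularities.ResolutionOfSingularities.Theorems.FRationalResolution.FixedChartsOfCharts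

/-- ★★★★★ **`hq ⇒ hq_fixed`.** For `X` over a field `k`: if every point of `X` lies in the image of an étale `k`-morphism
`Spec S₀ → X` from the degree-zero part of a regular finitely generated `k`-algebra graded by a finite abelian group (the hypothesis
`hq` of `stub_diagonalizableQuotientResolution`), then every point of `X` is the image of the contraction `v` of a FIXED prime `𝔔`
(`S_c ⊆ 𝔔` for all `c ≠ 0`) of such a chart. [folklore; cite: SGA3, Exp. VIII §4–5] -/
theorem fixed_charts_of_charts (k : Type) [Field k] (X : Scheme.{0}) (g : X ⟶ Spec (.of k))
    (hq : ∀ x : X, ∃ (A : Type) (_ : AddCommGroup A) (_ : Finite A) (_ : DecidableEq A)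
        (S : Type) (_ : CommRing S) (_ : Algebra k S) (𝒮 : A → Submodule k S)
        (_ : GradedAlgebra 𝒮), Algebra.FiniteType k S ∧ IsRegularRing S ∧
        ∃ φ : Spec (.of (𝒮 0)) ⟶ X, Etale φ ∧ x ∈ Set.range φ ∧
          φ ≫ g = Spec.map (CommRingCat.ofHom (algebraMap k (𝒮 0))))
    (x : X) :
    ∃ (A : Type) (_ : AddCommGroup A) (_ : Finite A) (_ : DecidableEq A)
      (S : Type) (_ : CommRing S) (_ : Algebra k S) (𝒮 : A → Submodule k S) (_ : GradedAlgebra 𝒮),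
      Algebra.FiniteType k S ∧ IsRegularRing S ∧
      ∃ (φ : Spec (.of (𝒮 0)) ⟶ X), Etale φ ∧
        φ ≫ g = Spec.map (CommRingCat.ofHom (algebraMap k (𝒮 0))) ∧
        ∃ (v : Spec (.of (𝒮 0))) (𝔔 : Ideal S) (_ : 𝔔.IsPrime),
          𝔔.comap (algebraMap (𝒮 0) S) = v.asIdeal ∧ (∀ c : A, c ≠ 0 → ∀ s ∈ 𝒮 c, s ∈ 𝔔) ∧ φ v = x := by
  obtain ⟨A, iA, fA, dA, S, iS, aS, 𝒮, g𝒮, hft, hreg, φ, hφ, ⟨v, rfl⟩, hcomp⟩ := hq x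
  haveI := hft
  haveI := hreg
  haveI := hφ
  obtain ⟨A', i1, i2, i3, S', i4, i5, 𝒮', i6, hft', hreg', φ', hφ'et, hφ'g, v', 𝔔', h𝔔'p, h𝔔'v', hfix, hφ'v⟩ :=
    FixedRechart.exists_fixed_rechart k X g A S 𝒮 φ hcomp v
  exact ⟨A', i1, i2, i3, S', i4, i5, 𝒮', i6, hft', hreg', φ', hφ'et, hφ'g, v', 𝔔', h𝔔'p, h𝔔'v', hfix, hφ'v⟩

end Summit.ResolutionOfSingularities.ResolutionOfSingularities.Theorems.FRationalResolution.FixedChartsOfCharts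

end
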